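/-
Width seat `ym-line-cbag-p1-w3` (prover-ym-line-cbag-p1-w3-g2-0), route `ColdBoxAllGroups`, crux `BulkAllGroups`
(stmt-QuantumFields-22255), line `dlr-chessboard-G` (lead `ym-line-cbag-p2`, skeleton v5): UNITS of the mean shift, `D` colours, scale `√β` —
G-port of `…BulkDominatesColdBoxWUnitsShift`, plus the `1/√2` reconciliation with the registered interfaces.
-/
import Summits.QuantumFields.YangMills.Theorems.ColdBoxAllGroupsOneScaleDatumDefsG
import Summits.QuantumFields.YangMills.Theorems.ColdBoxAllGroupsBulkAllGroupsGlueShiftBoundsG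

/-!
# Crux `BulkAllGroups` (stmt-QuantumFields-22255), stubs `stub_kernelMeanExpansionG` / `stub_kernelCovExpansionG`: the units dictionary
# between `qObsDE` (Dirichlet units, scaled datum `sdatE β ϑ = √β•ϑ`) and the interfaces' unscaled backgrounds `F̄`

G-port of `Theorems/WeakCouplingRatesBulkDominatesColdBoxWUnitsShift.lean` (`SU(2)`: three colours, scale `√(2β)`).  The lead's cores
(`abs_kernelMeanG_sub_gaussian_le_core₂`, `abs_kernelCovG_sub_gaussian_le_core₂` / `_moments`) take the quadratic surrogate in the form
`½Σ_c (F_c + dirCirc H p (t_c))²`; the ϑ-pass object is `qObsDE H D β ϑ p t = ½Σ_c (sCirc (glue ϑ'_c (mean ϑ'_c + t_c)) p)²` with the SCALED datum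
`ϑ' = sdatE β ϑ = √β•ϑ` (`…ColdBoxAllGroupsOneScaleDatumDefsG`: exponential chart, `β·cost_p ≈ ½|circ(√β·a)|²`, `ϑ` = the chart coordinates
`a` colour-major); the registered interfaces `KernelMeanExpansionG` / `KernelCovExpansionG` (`…ColdBoxAllGroupsDefs`) speak of an UNSCALED
background `F̄_c(p) = sCirc (glue ϑ_c (mean ϑ_c)) p` with constant terms `β·Σ_c F̄_c(x)²` and `2β(Σ_c F̄_c(p)F̄_c(q))·C_D` — the `SU(2)`
normalisation `cost ≈ |circ ϑ|²`, which in the exponential chart is met by the datum `ϑ/√2` (`½|circ a|² = |circ(a/√2)|²`).  Dictionary: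
* `dirBackground_sdatE_eq` — the background of the scaled datum is `√β·F̄_c` (width seat w2's `sCirc_glue_smul_mean`,
  `…BulkAllGroupsGlueShiftBoundsG`, which also has `½Σ_c(√β F̄_c)² = (β/2)·ΣF̄_c²` and the cross-term identity);
* `qObsDE_eq_half_sum_sq_unscaled` — `qObsDE H D β ϑ p t = ½Σ_c (√β·F̄_c(p) + dirCirc H p (t_c))²`;
* **the `1/√2` reconciliation** `half_beta_sum_sq_eq_beta_sum_sq_half`, `beta_sum_mul_eq_two_beta_sum_mul_half`,
  `dirBackground_half_eq` — with `ϑ⁰_c = (1/√2)•ϑ_c`: `F̄⁰_c = F̄_c/√2`, `(β/2)·ΣF̄_c² = β·Σ(F̄⁰_c)²` and `β·ΣF̄_c(p)F̄_c(q) = 2β·ΣF̄⁰_c(p)F̄⁰_c(q)`: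
  the constant terms the cores produce for the chart datum `ϑ` ARE the interface's terms for the datum `ϑ⁰ = ϑ/√2` (whose energy clause is half
  of `ϑ`'s, `sum_formM_smul_chartCoords`, and whose chart relation reads `W e = expChart ρ (√2 • datVec ϑ⁰ e)`, `datVec_smul_family`).
No new definition; standard axioms.  NOT a claim about the mass gap; the Yang–Mills mass gap is NOT proved by any of this.
-/

set_option autoImplicit false

noncomputable section

open Finset
open Literature.Probability.LatticeModels Literature.MathematicalPhysics.QuantumLattice
open Literature.MathematicalPhysics.QuantumFieldTheory Literature.MathematicalPhysics.QuantumFieldTheory.LatticeMaxwell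
open Summit.QuantumFields.YangMills.Theorems.WeakCouplingRates

namespace Summit.QuantumFields.YangMills.Theorems.ColdBoxAllGroups

variable {H : ℕ}

/-- **The background of the scaled datum is `√β` times the background of the datum.** -/
theorem dirBackground_sdatE_eq {D : ℕ} (β : ℝ) (ϑ : Fin D → Literature.MathematicalPhysics.QuantumLattice.ZdEdge 4 → ℝ) (c : Fin D)
    (p : Plaq 4) :
    sCirc (glue (pin := fun e => e ∉ dirFreeEdges H) dirCorner (2 * H + 3) (sdatE β ϑ c)
        (mean (fun e => e ∉ dirFreeEdges H) dirCorner (2 * H + 3) (sdatE β ϑ c))) p =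
      Real.sqrt β * sCirc (glue (pin := fun e => e ∉ dirFreeEdges H) dirCorner (2 * H + 3) (ϑ c)
        (mean (fun e => e ∉ dirFreeEdges H) dirCorner (2 * H + 3) (ϑ c))) p := by
  rw [sdatE_eq_smul]; exact sCirc_glue_smul_mean _ _ _

/-- **`qObsDE` in the cores' form with the UNSCALED background**: `qObsDE H D β ϑ p t = ½Σ_c (√β·F̄_c(p) + dirCirc H p (t_c))²`. -/
theorem qObsDE_eq_half_sum_sq_unscaled (D : ℕ) (β : ℝ) (ϑ : Fin D → Literature.MathematicalPhysics.QuantumLattice.ZdEdge 4 → ℝ)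
    (p : Plaq 4) (t : TSpaceD H D) :
    qObsDE H D β ϑ p t = 1 / 2 * ∑ c, (Real.sqrt β * sCirc (glue (pin := fun e => e ∉ dirFreeEdges H) dirCorner (2 * H + 3) (ϑ c)
        (mean (fun e => e ∉ dirFreeEdges H) dirCorner (2 * H + 3) (ϑ c))) p + dirCirc H p (t c)) ^ 2 := by
  rw [qObsDE_eq_half_sum_sq]
  congr 1
  exact Finset.sum_congr rfl fun c _ => by rw [dirBackground_sdatE_eq]

/-! ## The `1/√2` reconciliation with the registered interfaces -/

/-- `(β/2)·Σ_c F̄_c² = β·Σ_c (F̄_c/√2)²`. -/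
theorem half_beta_sum_sq_eq_beta_sum_sq_half {D : ℕ} (β : ℝ) (Fb : Fin D → ℝ) :
    β / 2 * ∑ c, Fb c ^ 2 = β * ∑ c, (1 / Real.sqrt 2 * Fb c) ^ 2 := by
  have h2 : Real.sqrt 2 ^ 2 = 2 := Real.sq_sqrt (by norm_num)
  have hs : (1 / Real.sqrt 2) ^ 2 = 1 / 2 := by rw [div_pow, one_pow, h2]
  simp_rw [mul_pow, hs]
  rw [← Finset.mul_sum]; ring

/-- `β·Σ_c F̄_c(p)F̄_c(q) = 2β·Σ_c (F̄_c(p)/√2)(F̄_c(q)/√2)`. -/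
theorem beta_sum_mul_eq_two_beta_sum_mul_half {D : ℕ} (β : ℝ) (Fp Fq : Fin D → ℝ) :
    β * ∑ c, Fp c * Fq c = 2 * β * ∑ c, (1 / Real.sqrt 2 * Fp c) * (1 / Real.sqrt 2 * Fq c) := by
  have h2 : Real.sqrt 2 * Real.sqrt 2 = 2 := Real.mul_self_sqrt (by norm_num)
  have hs : (1 / Real.sqrt 2) * (1 / Real.sqrt 2) = 1 / 2 := by
    rw [div_mul_div_comm, one_mul, h2]
  have : ∀ c, (1 / Real.sqrt 2 * Fp c) * (1 / Real.sqrt 2 * Fq c) = 1 / 2 * (Fp c * Fq c) := fun c => by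
    rw [show (1 / Real.sqrt 2 * Fp c) * (1 / Real.sqrt 2 * Fq c) = ((1 / Real.sqrt 2) * (1 / Real.sqrt 2)) * (Fp c * Fq c) by ring, hs]
  simp_rw [this]
  rw [← Finset.mul_sum]; ring

/-- **The background of the half-scaled datum** `ϑ⁰_c = (1/√2)•ϑ_c` is `F̄_c/√2`. -/
theorem dirBackground_half_eq {D : ℕ} (ϑ : Fin D → Literature.MathematicalPhysics.QuantumLattice.ZdEdge 4 → ℝ) (c : Fin D) (p : Plaq 4) :
    sCirc (glue (pin := fun e => e ∉ dirFreeEdges H) dirCorner (2 * H + 3) ((1 / Real.sqrt 2) • ϑ c)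
        (mean (fun e => e ∉ dirFreeEdges H) dirCorner (2 * H + 3) ((1 / Real.sqrt 2) • ϑ c))) p =
      1 / Real.sqrt 2 * sCirc (glue (pin := fun e => e ∉ dirFreeEdges H) dirCorner (2 * H + 3) (ϑ c)
        (mean (fun e => e ∉ dirFreeEdges H) dirCorner (2 * H + 3) (ϑ c))) p :=
  sCirc_glue_smul_mean _ _ _

/-- **Mean-core constant term ⇒ interface term**: `(β/2)·Σ_c F̄_c(x)² = β·Σ_c F̄⁰_c(x)²` with `ϑ⁰ = ϑ/√2`. -/
theorem half_beta_sum_dirBackground_sq_eq {D : ℕ} (β : ℝ) (ϑ : Fin D → Literature.MathematicalPhysics.QuantumLattice.ZdEdge 4 → ℝ)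
    (p : Plaq 4) :
    β / 2 * (∑ c, (sCirc (glue (pin := fun e => e ∉ dirFreeEdges H) dirCorner (2 * H + 3) (ϑ c)
        (mean (fun e => e ∉ dirFreeEdges H) dirCorner (2 * H + 3) (ϑ c))) p) ^ 2) =
      β * (∑ c, (sCirc (glue (pin := fun e => e ∉ dirFreeEdges H) dirCorner (2 * H + 3) ((1 / Real.sqrt 2) • ϑ c)
        (mean (fun e => e ∉ dirFreeEdges H) dirCorner (2 * H + 3) ((1 / Real.sqrt 2) • ϑ c))) p) ^ 2) := by
  rw [half_beta_sum_sq_eq_beta_sum_sq_half]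
  congr 1
  exact Finset.sum_congr rfl fun c _ => by rw [dirBackground_half_eq]

/-- **Covariance-core cross term ⇒ interface term**: `β·Σ_c F̄_c(p)F̄_c(q) = 2β·Σ_c F̄⁰_c(p)F̄⁰_c(q)` with `ϑ⁰ = ϑ/√2`. -/
theorem beta_sum_dirBackground_mul_eq {D : ℕ} (β : ℝ) (ϑ : Fin D → Literature.MathematicalPhysics.QuantumLattice.ZdEdge 4 → ℝ)
    (p q : Plaq 4) :
    β * (∑ c, sCirc (glue (pin := fun e => e ∉ dirFreeEdges H) dirCorner (2 * H + 3) (ϑ c)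
        (mean (fun e => e ∉ dirFreeEdges H) dirCorner (2 * H + 3) (ϑ c))) p *
      sCirc (glue (pin := fun e => e ∉ dirFreeEdges H) dirCorner (2 * H + 3) (ϑ c)
        (mean (fun e => e ∉ dirFreeEdges H) dirCorner (2 * H + 3) (ϑ c))) q) =
      2 * β * (∑ c, sCirc (glue (pin := fun e => e ∉ dirFreeEdges H) dirCorner (2 * H + 3) ((1 / Real.sqrt 2) • ϑ c)
        (mean (fun e => e ∉ dirFreeEdges H) dirCorner (2 * H + 3) ((1 / Real.sqrt 2) • ϑ c))) p *
      sCirc (glue (pin := fun e => e ∉ dirFreeEdges H) dirCorner (2 * H + 3) ((1 / Real.sqrt 2) • ϑ c)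
        (mean (fun e => e ∉ dirFreeEdges H) dirCorner (2 * H + 3) ((1 / Real.sqrt 2) • ϑ c))) q) := by
  rw [beta_sum_mul_eq_two_beta_sum_mul_half]
  congr 1
  exact Finset.sum_congr rfl fun c _ => by rw [dirBackground_half_eq, dirBackground_half_eq]

end Summit.QuantumFields.YangMills.Theorems.ColdBoxAllGroups

end
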